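import Mathlib

/-!
# Elements of prescribed signs at three real embeddings (Tier 5, datum row A1)

Row A1 of route/T5-route-3.md (the Tier-5 DATUM) needs an element `u ∈ F⁺` of the cubic totally
real field `F⁺` with signs `(+, −, +)` at the three real embeddings `ι₁, ι₂, ι₃`, and discharges
its existence by «weak approximation at the three real places [A, standard]».  This file
kernel-checks that existence by an elementary construction: if `θ ∈ F⁺` has distinct images
`ι₁ θ < ι₂ θ < ι₃ θ` (any primitive element, after numbering the embeddings by the order of its
images), pick rationals `c₁ ∈ (ι₁ θ, ι₂ θ)` and `c₂ ∈ (ι₂ θ, ι₃ θ)`; then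
`u := (θ − c₁)(θ − c₂)` has the signs `(+, −, +)`.  No approximation theorem is needed.
The other patterns are obtained from one-factor elements `θ − c`, `c − θ` (`exists_neg_pos_pos`,
`exists_pos_pos_neg`) and products (`exists_neg_neg_pos`); the numbering of the embeddings is
immaterial — any `θ` with three pairwise distinct real images can be used after renumbering.
-/

namespace Summit.Ventures.HodgeRepro2.SignPattern

variable {F : Type*} [Field F]

/-- **Row A1 of the Tier-5 datum.** If `θ ∈ F` has `ι₁ θ < ι₂ θ < ι₃ θ` at three real embeddings,
then `u := (θ − c₁)(θ − c₂)`, with rationals `c₁ ∈ (ι₁ θ, ι₂ θ)` and `c₂ ∈ (ι₂ θ, ι₃ θ)`, has the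
signs `(+, −, +)` at `(ι₁, ι₂, ι₃)`. -/
theorem exists_pos_neg_pos (ι₁ ι₂ ι₃ : F →+* ℝ) (θ : F) (h12 : ι₁ θ < ι₂ θ)
    (h23 : ι₂ θ < ι₃ θ) : ∃ u : F, 0 < ι₁ u ∧ ι₂ u < 0 ∧ 0 < ι₃ u := by
  obtain ⟨c₁, hc₁, hc₁'⟩ := exists_rat_btwn h12
  obtain ⟨c₂, hc₂, hc₂'⟩ := exists_rat_btwn h23
  refine ⟨(θ - c₁) * (θ - c₂), ?_, ?_, ?_⟩
  · simp only [map_mul, map_sub, map_ratCast]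
    exact mul_pos_of_neg_of_neg (by linarith) (by linarith)
  · simp only [map_mul, map_sub, map_ratCast]
    exact mul_neg_of_pos_of_neg (by linarith) (by linarith)
  · simp only [map_mul, map_sub, map_ratCast]
    exact mul_pos (by linarith) (by linarith)

/-- The pattern `(−, +, +)`: `u := θ − c` with a rational `c ∈ (ι₁ θ, ι₂ θ)`. -/
theorem exists_neg_pos_pos (ι₁ ι₂ ι₃ : F →+* ℝ) (θ : F) (h12 : ι₁ θ < ι₂ θ)
    (h23 : ι₂ θ < ι₃ θ) : ∃ u : F, ι₁ u < 0 ∧ 0 < ι₂ u ∧ 0 < ι₃ u := by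
  obtain ⟨c, hc, hc'⟩ := exists_rat_btwn h12
  refine ⟨θ - c, ?_, ?_, ?_⟩ <;> simp only [map_sub, map_ratCast] <;> linarith

/-- The pattern `(+, +, −)`: `u := c − θ` with a rational `c ∈ (ι₂ θ, ι₃ θ)`. -/
theorem exists_pos_pos_neg (ι₁ ι₂ ι₃ : F →+* ℝ) (θ : F) (h12 : ι₁ θ < ι₂ θ)
    (h23 : ι₂ θ < ι₃ θ) : ∃ u : F, 0 < ι₁ u ∧ 0 < ι₂ u ∧ ι₃ u < 0 := by
  obtain ⟨c, hc, hc'⟩ := exists_rat_btwn h23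
  refine ⟨(c : F) - θ, ?_, ?_, ?_⟩ <;> simp only [map_sub, map_ratCast] <;> linarith

/-- The two-minus patterns are products of one-minus patterns; e.g. `(−, −, +)`. -/
theorem exists_neg_neg_pos (ι₁ ι₂ ι₃ : F →+* ℝ) (θ : F) (h12 : ι₁ θ < ι₂ θ)
    (h23 : ι₂ θ < ι₃ θ) : ∃ u : F, ι₁ u < 0 ∧ ι₂ u < 0 ∧ 0 < ι₃ u := by
  obtain ⟨a, ha1, ha2, ha3⟩ := exists_neg_pos_pos ι₁ ι₂ ι₃ θ h12 h23
  obtain ⟨b, hb1, hb2, hb3⟩ := exists_pos_neg_pos ι₁ ι₂ ι₃ θ h12 h23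
  exact ⟨a * b, by rw [map_mul]; exact mul_neg_of_neg_of_pos ha1 hb1,
    by rw [map_mul]; exact mul_neg_of_pos_of_neg ha2 hb2, by rw [map_mul]; exact mul_pos ha3 hb3⟩

end Summit.Ventures.HodgeRepro2.SignPattern
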